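import Mathlib
import HarnessLib
import Literature.NumberTheory.LFunctions.DoubleLargeSieve

/-!
# Robert–Sargos 2002, Lemma 4: the double large sieve for the triple sums `S̃` — PROVED

Topic `Literature/NumberTheory/LFunctions`. Everything in this file is PROVED (no `sorry`, no named
facts). It is Lemma 4 (§2.4, (2·8)–(2·13)) of O. Robert, P. Sargos, *A fourth derivative test for
exponential sums*, Compositio Math. 130 (2002) 275–292 (= arXiv:2307.03562v1), the form of the
Bombieri–Iwaniec double large sieve used in Step 5 of the proof of their Theorem 1:

> Let `S̃ = ∑_{0<|r|<R} ∑_{m=1}^{M} |∑_{0<|q|<Q} ∑_{H ≤ h < 2H} ∑_{n ≤ N} b_r(q,h,n) e(x_m P₁(r,q,h,n) + y_m P₂(r,q,h,n))|`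
> with `|b_r| ≤ 1`, `P₁` integer valued, `P₂` real, `max |y_m - y_{m'}| ≤ μ` (2·9), `|P_i| ≤ X_i`
> (2·10). Then `S̃² ≪ R(1 + X₁)(1 + μX₂) 𝒩 ℬ (log Q)²` (2·13), where (2·11)
> `𝒩 = max_{Q₁} #{(r, y, y') : y, y' in the dyadic class Q₁ ≤ |q| < 2Q₁, P₁(r,y) = P₁(r,y'), |P₂(r,y) - P₂(r,y')| ≤ 1/μ}`
> and (2·12) `ℬ = #{(m₁, m₂) : ‖x_{m₁} - x_{m₂}‖ ≤ X₁⁻¹, |y_{m₁} - y_{m₂}| ≤ X₂⁻¹}`.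

Proof as printed: split the `q`-range dyadically (2·14), apply the double large sieve
(`Literature.NumberTheory.LFunctions.DoubleLargeSieve.doubleLargeSieve_count`, the tree's Graham–Kolesnik
Lemma 7.5) to each `S̃(r, Q₁)` in dimension `K = 2` (2·15), and Cauchy over `r`. The reduction of the
`x`-coordinate modulo `1` ("‖·‖") is done by replacing `x_m` with `{x_m} - 1/2 ∈ [-1, 1]` and absorbing
the unimodular factors `e(⌊x_m⌋P₁) = 1`, `e(P₁/2)`, `e(y_{m₀}P₂)` into `b` (possible because `P₁ ∈ ℤ`);
with the box `X = 1` for that coordinate the neighbour threshold `(2X)⁻¹ = 1/2` forces `P₁ = P₁'`.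

## Statement proved (generic in the index sets; constants explicit)

`RobertSargos.lemma4`: for a finite set `Rs` of "`r`", finite sets `Ys r` of "`y = (q,h,n)`" with a class
map `cls r : Ys r → {0,…,D-1}` (the dyadic classes; any partition works), a finite set `ms` of "`m`",
`|b| ≤ 1`, `|P₁| ≤ X₁`, `|P₂| ≤ X₂`, `|y_m - y_{m'}| ≤ μ` (`X₁, X₂, μ > 0`):
`(∑_r ∑_m |∑_{y ∈ Ys r} b_r(y) e(x_m P₁ + y_m P₂)|)² ≤ 624² D² #Rs (1 + X₁)(1 + μX₂) 𝒩 ℬ`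
where `𝒩` bounds, for every class `c`, `∑_r #{(y,y') ∈ (Ys r ∩ cls⁻¹ c)² : P₁ = P₁', |P₂ - P₂'| ≤ 1/μ}`
and `ℬ` bounds `#{(m,m') ∈ ms² : ∃ k ∈ ℤ, |x_m - x_{m'} - k| ≤ (2X₁)⁻¹, |y_m - y_{m'}| ≤ (2X₂)⁻¹}` (a subset
of the printed `ℬ`). The dyadic count `D = ⌊log₂ Q⌋ + 1` gives the printed `(log Q)²`.
`RobertSargos.doubleLargeSieve_RS` is the case of a single `r` and a single class ((2·15)).

## References

* O. Robert, P. Sargos, *A fourth derivative test for exponential sums*, Compositio Math. 130 (2002),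
  275–292, doi:10.1023/A:1014363224308 = arXiv:2307.03562v1 — §2.4, Lemma 4, (2·8)–(2·15).
  [RobertSargos2002]
* S. W. Graham, G. Kolesnik, *Van der Corput's Method of Exponential Sums*, CUP 1991, Lemma 7.5
  (the tree's `DoubleLargeSieve.lean`). [GrahamKolesnik1991]
-/

noncomputable section

open Finset
open scoped ComplexConjugate

namespace Literature.NumberTheory.LFunctions
namespace RobertSargos

open Literature.NumberTheory.LFunctions.VdC (e norm_e e_add e_int)
open Literature.NumberTheory.LFunctions.DoubleLargeSieve (closePairs doubleLargeSieve_count)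

/-! ### Small facts about `e` -/

/-- `e(x + n) = e(x)` for integers `n`: `e(n x)`-type reduction used for `e(⌊x⌋ P₁) = 1`. [folklore] -/
theorem e_int_mul_eq_one (n k : ℤ) : e ((n : ℝ) * k) = 1 := by
  have : ((n : ℝ) * k) = ((n * k : ℤ) : ℝ) := by push_cast; ring
  rw [this]; exact e_int _

/-- For every complex `z` there is `a` with `‖a‖ ≤ 1` and `a z = ‖z‖`. [folklore] -/
theorem exists_unit_mul_eq_norm (z : ℂ) : ∃ a : ℂ, ‖a‖ ≤ 1 ∧ a * z = (‖z‖ : ℂ) := by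
  rcases eq_or_ne z 0 with rfl | hz
  · exact ⟨0, by simp, by simp⟩
  · refine ⟨conj z / (‖z‖ : ℂ), ?_, ?_⟩
    · rw [norm_div, Complex.norm_conj, Complex.norm_real, Real.norm_eq_abs, abs_of_pos (norm_pos_iff.mpr hz),
        div_self (norm_ne_zero_iff.mpr hz)]
    · have hn : (‖z‖ : ℂ) ≠ 0 := by exact_mod_cast norm_ne_zero_iff.mpr hz
      rw [div_mul_eq_mul_div, div_eq_iff hn, Complex.conj_mul']; ring

/-! ### The double large sieve for one `r` and one class ((2·15)) -/

open Classical in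
/-- **[RS] (2·15)**: for one value of `r` and one dyadic class,
`(∑_m |∑_y b(y) e(x_m P₁(y) + y_m P₂(y))|)² ≤ 624² (1 + X₁)(1 + μX₂) · ℬ · 𝒩`, with
`ℬ = #{(m,m') : ∃ k ∈ ℤ, |x_m - x_{m'} - k| ≤ (2X₁)⁻¹, |y_m - y_{m'}| ≤ (2X₂)⁻¹}` and
`𝒩 = #{(y,y') : P₁(y) = P₁(y'), |P₂(y) - P₂(y')| ≤ 1/μ}` (`|b| ≤ 1`, `P₁ ∈ ℤ`, `|P₁| ≤ X₁`, `|P₂| ≤ X₂`,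
`|y_m - y_{m'}| ≤ μ`). [cite: RobertSargos2002, Lemma 4, (2.15)] -/
theorem doubleLargeSieve_RS {σ τ : Type*} (Y : Finset σ) (ms : Finset τ) (P₁ : σ → ℤ) (P₂ : σ → ℝ)
    (b : σ → ℂ) (x y : τ → ℝ) {X₁ X₂ μ : ℝ} (hX₁ : 0 < X₁) (hX₂ : 0 < X₂) (hμ : 0 < μ)
    (hb : ∀ s ∈ Y, ‖b s‖ ≤ 1) (hP₁ : ∀ s ∈ Y, |(P₁ s : ℝ)| ≤ X₁) (hP₂ : ∀ s ∈ Y, |P₂ s| ≤ X₂)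
    (hy : ∀ m ∈ ms, ∀ m' ∈ ms, |y m - y m'| ≤ μ) :
    (∑ m ∈ ms, ‖∑ s ∈ Y, b s * e (x m * P₁ s + y m * P₂ s)‖) ^ 2 ≤
      624 ^ 2 * ((1 + X₁) * (1 + μ * X₂)) *
        ((ms ×ˢ ms).filter fun mm => (∃ k : ℤ, |x mm.1 - x mm.2 - k| ≤ (2 * X₁)⁻¹) ∧
          |y mm.1 - y mm.2| ≤ (2 * X₂)⁻¹).card *
        ((Y ×ˢ Y).filter fun ss => P₁ ss.1 = P₁ ss.2 ∧ |P₂ ss.1 - P₂ ss.2| ≤ 1 / μ).card := by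
  rcases ms.eq_empty_or_nonempty with hme | ⟨m₀, hm₀⟩
  · rw [hme]; simp
  set y₀ : ℝ := y m₀ with hy₀
  -- the recentred points and the twisted weights
  set xt : τ → Fin 2 → ℝ := fun m => ![Int.fract (x m) - 1 / 2, y m - y₀] with hxt
  set yt : σ → Fin 2 → ℝ := fun s => ![(P₁ s : ℝ), P₂ s] with hyt
  set Xv : Fin 2 → ℝ := ![1, μ] with hXv
  set Yv : Fin 2 → ℝ := ![X₁, X₂] with hYv
  set b' : σ → ℂ := fun s => b s * e ((P₁ s : ℝ) / 2 + y₀ * P₂ s) with hb'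
  -- the phases agree
  have hphase : ∀ m s, e (x m * P₁ s + y m * P₂ s) =
      e (∑ k, xt m k * yt s k) * e ((P₁ s : ℝ) / 2 + y₀ * P₂ s) := by
    intro m s
    rw [← e_add, Fin.sum_univ_two]
    simp only [hxt, hyt, Matrix.cons_val_zero, Matrix.cons_val_one]
    have hx : (⌊x m⌋ : ℝ) + Int.fract (x m) = x m := Int.floor_add_fract (x m)
    have : x m * P₁ s + y m * P₂ s =
        ((Int.fract (x m) - 1 / 2) * P₁ s + (y m - y₀) * P₂ s + ((P₁ s : ℝ) / 2 + y₀ * P₂ s)) +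
          (⌊x m⌋ : ℝ) * (P₁ s : ℤ) := by linear_combination (-(P₁ s : ℝ)) * hx
    rw [this, e_add, e_int_mul_eq_one, mul_one]
  have hinner : ∀ m, ∑ s ∈ Y, b s * e (x m * P₁ s + y m * P₂ s) =
      ∑ s ∈ Y, b' s * e (∑ k, xt m k * yt s k) := by
    intro m
    refine Finset.sum_congr rfl fun s _ => ?_
    rw [hphase, hb']; ring
  -- unit multipliers turning moduli into a bilinear form
  choose a ha using fun m => exists_unit_mul_eq_norm (∑ s ∈ Y, b' s * e (∑ k, xt m k * yt s k))
  have hsum : ((∑ m ∈ ms, ‖∑ s ∈ Y, b s * e (x m * P₁ s + y m * P₂ s)‖ : ℝ) : ℂ) =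
      ∑ m ∈ ms, ∑ s ∈ Y, a m * b' s * e (∑ k, xt m k * yt s k) := by
    push_cast
    refine Finset.sum_congr rfl fun m _ => ?_
    rw [hinner m, ← (ha m).2, Finset.mul_sum]
    refine Finset.sum_congr rfl fun s _ => ?_
    ring
  have hnorm : (∑ m ∈ ms, ‖∑ s ∈ Y, b s * e (x m * P₁ s + y m * P₂ s)‖) =
      ‖∑ m ∈ ms, ∑ s ∈ Y, a m * b' s * e (∑ k, xt m k * yt s k)‖ := by
    rw [← hsum, Complex.norm_real, Real.norm_eq_abs,
      abs_of_nonneg (Finset.sum_nonneg fun m _ => norm_nonneg _)]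
  rw [hnorm]
  -- the double large sieve in dimension 2
  have hXv0 : ∀ k, 0 < Xv k := fun k => by fin_cases k <;> simp [hXv, hμ]
  have hYv0 : ∀ k, 0 < Yv k := fun k => by fin_cases k <;> simp [hYv, hX₁, hX₂]
  have hxv : ∀ m ∈ ms, ∀ k, |xt m k| ≤ Xv k := by
    intro m hm k
    fin_cases k
    · simp only [hxt, hXv, Fin.zero_eta, Fin.isValue, Matrix.cons_val_zero]
      have h1 := Int.fract_nonneg (x m); have h2 := Int.fract_lt_one (x m)
      rw [abs_le]; constructor <;> linarith
    · simp only [hxt, hXv, Fin.mk_one, Fin.isValue, Matrix.cons_val_one]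
      exact hy m hm m₀ hm₀
  have hyv : ∀ s ∈ Y, ∀ k, |yt s k| ≤ Yv k := by
    intro s hs k
    fin_cases k
    · simpa [hyt, hYv] using hP₁ s hs
    · simpa [hyt, hYv] using hP₂ s hs
  have ha1 : ∀ m ∈ ms, ‖a m‖ ≤ 1 := fun m _ => (ha m).1
  have hb1 : ∀ s ∈ Y, ‖b' s‖ ≤ 1 := by
    intro s hs
    rw [hb']; simp only
    rw [norm_mul, norm_e, mul_one]; exact hb s hs
  have hdls := doubleLargeSieve_count ms Y xt yt a b' Xv Yv hXv0 hYv0 hxv hyv ha1 hb1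
  refine hdls.trans ?_
  -- compare the constants and the counts
  have hprod : ∏ k, (1 + Xv k * Yv k) = (1 + X₁) * (1 + μ * X₂) := by
    rw [Fin.prod_univ_two]; simp [hXv, hYv]
  have hcard : Fintype.card (Fin 2) = 2 := Fintype.card_fin 2
  rw [hcard, hprod]
  have hB : (closePairs ms xt (fun k => (2 * Yv k)⁻¹) : ℝ) ≤
      ((ms ×ˢ ms).filter fun mm => (∃ k : ℤ, |x mm.1 - x mm.2 - k| ≤ (2 * X₁)⁻¹) ∧
          |y mm.1 - y mm.2| ≤ (2 * X₂)⁻¹).card := by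
    rw [closePairs]
    exact_mod_cast Finset.card_le_card (Finset.monotone_filter_right _ fun mm _ hmm => by
      have h0 := hmm 0
      have h1 := hmm 1
      simp only [hxt, hYv, Fin.isValue, Matrix.cons_val_zero, Matrix.cons_val_one] at h0 h1
      refine ⟨⟨⌊x mm.1⌋ - ⌊x mm.2⌋, ?_⟩, by convert h1 using 2; ring⟩
      have e1 := Int.floor_add_fract (x mm.1)
      have e2 := Int.floor_add_fract (x mm.2)
      have : x mm.1 - x mm.2 - ((⌊x mm.1⌋ - ⌊x mm.2⌋ : ℤ) : ℝ) =
          Int.fract (x mm.1) - 1 / 2 - (Int.fract (x mm.2) - 1 / 2) := by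
        push_cast; linarith
      rw [this]; exact h0)
  have hN : (closePairs Y yt (fun k => (2 * Xv k)⁻¹) : ℝ) ≤
      ((Y ×ˢ Y).filter fun ss => P₁ ss.1 = P₁ ss.2 ∧ |P₂ ss.1 - P₂ ss.2| ≤ 1 / μ).card := by
    rw [closePairs]
    exact_mod_cast Finset.card_le_card (Finset.monotone_filter_right _ fun ss _ hss => by
      have h0 := hss 0
      have h1 := hss 1
      simp only [hyt, hXv, Fin.isValue, Matrix.cons_val_zero, Matrix.cons_val_one] at h0 h1
      constructor
      · -- integers within `1/2` are equal
        have h2 : |((P₁ ss.1 - P₁ ss.2 : ℤ) : ℝ)| < 1 := by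
          push_cast; norm_num at h0; linarith
        rw [← Int.cast_abs] at h2
        have h3 : |P₁ ss.1 - P₁ ss.2| < 1 := by exact_mod_cast h2
        have h4 : P₁ ss.1 - P₁ ss.2 = 0 := Int.abs_lt_one_iff.mp h3
        linarith
      · refine h1.trans ?_
        rw [one_div, inv_le_inv₀ (by positivity) hμ]; linarith)
  have hpos : (0 : ℝ) ≤ 624 ^ 2 * ((1 + X₁) * (1 + μ * X₂)) := by positivity
  have hB0 : (0 : ℝ) ≤ closePairs ms xt (fun k => (2 * Yv k)⁻¹) := by positivity
  calc (624 : ℝ) ^ 2 * ((1 + X₁) * (1 + μ * X₂)) * (closePairs ms xt fun k => (2 * Yv k)⁻¹) *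
        (closePairs Y yt fun k => (2 * Xv k)⁻¹)
      = 624 ^ 2 * ((1 + X₁) * (1 + μ * X₂)) * ((closePairs ms xt fun k => (2 * Yv k)⁻¹) *
        (closePairs Y yt fun k => (2 * Xv k)⁻¹)) := by ring
    _ ≤ 624 ^ 2 * ((1 + X₁) * (1 + μ * X₂)) *
        ((((ms ×ˢ ms).filter fun mm => (∃ k : ℤ, |x mm.1 - x mm.2 - k| ≤ (2 * X₁)⁻¹) ∧
          |y mm.1 - y mm.2| ≤ (2 * X₂)⁻¹).card : ℝ) *
        ((Y ×ˢ Y).filter fun ss => P₁ ss.1 = P₁ ss.2 ∧ |P₂ ss.1 - P₂ ss.2| ≤ 1 / μ).card) := by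
        apply mul_le_mul_of_nonneg_left _ hpos
        exact mul_le_mul hB hN (by positivity) (by positivity)
    _ = _ := by ring

/-! ### Lemma 4: classes, the sum over `r`, Cauchy -/

open Classical in
/-- **Robert–Sargos 2002, Lemma 4** (generic form, explicit constant): with `D` classes on each `Ys r`
(`cls r s < D`), `|b| ≤ 1`, `P₁ ∈ ℤ`, `|P₁| ≤ X₁`, `|P₂| ≤ X₂`, `|y_m - y_{m'}| ≤ μ`, a bound `Nv` for the
class-wise solution counts `∑_r #{(y,y') ∈ (Ys r ∩ cls⁻¹c)² : P₁ = P₁', |P₂ - P₂'| ≤ 1/μ}` (the `𝒩` of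
(2·11)) and a bound `Bv` for `#{(m,m') : ‖x_m - x_{m'}‖ ≤ (2X₁)⁻¹, |y_m - y_{m'}| ≤ (2X₂)⁻¹}` (at most the
`ℬ` of (2·12)):
`(∑_r ∑_m |∑_{y ∈ Ys r} b_r(y) e(x_m P₁(r,y) + y_m P₂(r,y))|)² ≤ 624² D² #Rs (1 + X₁)(1 + μX₂) Nv Bv`
— the printed `S̃² ≪ R(1 + X₁)(1 + μX₂)𝒩ℬ(log Q)²` (2·13) with `D = O(log Q)` dyadic classes.
[cite: RobertSargos2002, Lemma 4, (2.13)] -/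
theorem lemma4 {ρ σ τ : Type*} (Rs : Finset ρ) (Ys : ρ → Finset σ) (ms : Finset τ)
    (P₁ : ρ → σ → ℤ) (P₂ : ρ → σ → ℝ) (b : ρ → σ → ℂ) (x y : τ → ℝ) (cls : ρ → σ → ℕ) (D : ℕ)
    {X₁ X₂ μ : ℝ} (hX₁ : 0 < X₁) (hX₂ : 0 < X₂) (hμ : 0 < μ)
    (hb : ∀ r ∈ Rs, ∀ s ∈ Ys r, ‖b r s‖ ≤ 1) (hcls : ∀ r ∈ Rs, ∀ s ∈ Ys r, cls r s < D)
    (hP₁ : ∀ r ∈ Rs, ∀ s ∈ Ys r, |(P₁ r s : ℝ)| ≤ X₁) (hP₂ : ∀ r ∈ Rs, ∀ s ∈ Ys r, |P₂ r s| ≤ X₂)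
    (hy : ∀ m ∈ ms, ∀ m' ∈ ms, |y m - y m'| ≤ μ) {Nv Bv : ℝ}
    (hN : ∀ c, c < D → (∑ r ∈ Rs, (((((Ys r).filter (fun s => cls r s = c)) ×ˢ
        ((Ys r).filter (fun s => cls r s = c))).filter (fun ss =>
          P₁ r ss.1 = P₁ r ss.2 ∧ |P₂ r ss.1 - P₂ r ss.2| ≤ 1 / μ)).card : ℝ)) ≤ Nv)
    (hB : (((ms ×ˢ ms).filter (fun mm => (∃ k : ℤ, |x mm.1 - x mm.2 - k| ≤ (2 * X₁)⁻¹) ∧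
          |y mm.1 - y mm.2| ≤ (2 * X₂)⁻¹)).card : ℝ) ≤ Bv) :
    (∑ r ∈ Rs, ∑ m ∈ ms, ‖∑ s ∈ Ys r, b r s * e (x m * P₁ r s + y m * P₂ r s)‖) ^ 2 ≤
      624 ^ 2 * (D : ℝ) ^ 2 * Rs.card * ((1 + X₁) * (1 + μ * X₂)) * Nv * Bv := by
  -- the class-wise pieces (no `set`: the expressions are large)
  obtain ⟨Tcr, hTcr⟩ : ∃ T : ℕ → ρ → ℝ, T = fun c r => ∑ m ∈ ms,
      ‖∑ s ∈ (Ys r).filter (fun s => cls r s = c), b r s * e (x m * P₁ r s + y m * P₂ r s)‖ :=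
    ⟨_, rfl⟩
  have hBv0 : 0 ≤ Bv := le_trans (Nat.cast_nonneg _) hB
  have hK0 : (0 : ℝ) ≤ 624 ^ 2 * ((1 + X₁) * (1 + μ * X₂)) := by positivity
  -- Step 1: `T ≤ ∑_{c < D} ∑_r T_c(r)`
  have hmaps : ∀ r ∈ Rs, ∀ s ∈ Ys r, cls r s ∈ Finset.range D :=
    fun r hr s hs => Finset.mem_range.mpr (hcls r hr s hs)
  have hstep1 : ∑ r ∈ Rs, ∑ m ∈ ms, ‖∑ s ∈ Ys r, b r s * e (x m * P₁ r s + y m * P₂ r s)‖ ≤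
      ∑ c ∈ Finset.range D, ∑ r ∈ Rs, Tcr c r := by
    rw [hTcr, Finset.sum_comm (s := Finset.range D) (t := Rs)]
    refine Finset.sum_le_sum fun r hr => ?_
    rw [Finset.sum_comm (s := Finset.range D) (t := ms)]
    refine Finset.sum_le_sum fun m _ => ?_
    rw [← Finset.sum_fiberwise_of_maps_to (hmaps r hr)
      (fun s => b r s * e (x m * P₁ r s + y m * P₂ r s))]
    exact norm_sum_le _ _
  -- Step 2: each `T_c(r)² ≤ 624²(…) · ℬ · 𝒩(r,c)`
  have hstep2 : ∀ c r, r ∈ Rs → Tcr c r ^ 2 ≤ 624 ^ 2 * ((1 + X₁) * (1 + μ * X₂)) *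
      ((ms ×ˢ ms).filter (fun mm => (∃ k : ℤ, |x mm.1 - x mm.2 - k| ≤ (2 * X₁)⁻¹) ∧
          |y mm.1 - y mm.2| ≤ (2 * X₂)⁻¹)).card *
      ((((Ys r).filter (fun s => cls r s = c)) ×ˢ ((Ys r).filter (fun s => cls r s = c))).filter
        (fun ss => P₁ r ss.1 = P₁ r ss.2 ∧ |P₂ r ss.1 - P₂ r ss.2| ≤ 1 / μ)).card := by
    intro c r hr
    rw [hTcr]
    exact doubleLargeSieve_RS ((Ys r).filter fun s => cls r s = c) ms (P₁ r) (P₂ r) (b r) x y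
      hX₁ hX₂ hμ (fun s hs => hb r hr s (Finset.mem_filter.mp hs).1)
      (fun s hs => hP₁ r hr s (Finset.mem_filter.mp hs).1)
      (fun s hs => hP₂ r hr s (Finset.mem_filter.mp hs).1) hy
  -- Step 3: Cauchy over `r`, sum of the counts
  have hstep3 : ∀ c, c < D → (∑ r ∈ Rs, Tcr c r) ^ 2 ≤
      Rs.card * (624 ^ 2 * ((1 + X₁) * (1 + μ * X₂)) * Bv * Nv) := by
    intro c hc
    have hCS : (∑ r ∈ Rs, Tcr c r) ^ 2 ≤ Rs.card * ∑ r ∈ Rs, Tcr c r ^ 2 := sq_sum_le_card_mul_sum_sq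
    refine hCS.trans (mul_le_mul_of_nonneg_left ?_ (by positivity))
    calc ∑ r ∈ Rs, Tcr c r ^ 2
        ≤ ∑ r ∈ Rs, 624 ^ 2 * ((1 + X₁) * (1 + μ * X₂)) * Bv *
          ((((Ys r).filter (fun s => cls r s = c)) ×ˢ ((Ys r).filter (fun s => cls r s = c))).filter
            (fun ss => P₁ r ss.1 = P₁ r ss.2 ∧ |P₂ r ss.1 - P₂ r ss.2| ≤ 1 / μ)).card := by
          refine Finset.sum_le_sum fun r hr => (hstep2 c r hr).trans ?_
          apply mul_le_mul_of_nonneg_right _ (by positivity)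
          exact mul_le_mul_of_nonneg_left hB hK0
      _ = 624 ^ 2 * ((1 + X₁) * (1 + μ * X₂)) * Bv *
          ∑ r ∈ Rs, (((((Ys r).filter (fun s => cls r s = c)) ×ˢ ((Ys r).filter (fun s => cls r s = c))).filter
            (fun ss => P₁ r ss.1 = P₁ r ss.2 ∧ |P₂ r ss.1 - P₂ r ss.2| ≤ 1 / μ)).card : ℝ) := by
          rw [Finset.mul_sum]
      _ ≤ 624 ^ 2 * ((1 + X₁) * (1 + μ * X₂)) * Bv * Nv :=
          mul_le_mul_of_nonneg_left (hN c hc) (by positivity)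
  -- Step 4: Cauchy over the classes
  have hT0 : 0 ≤ ∑ r ∈ Rs, ∑ m ∈ ms, ‖∑ s ∈ Ys r, b r s * e (x m * P₁ r s + y m * P₂ r s)‖ :=
    Finset.sum_nonneg fun r _ => Finset.sum_nonneg fun m _ => norm_nonneg _
  have hsq : (∑ r ∈ Rs, ∑ m ∈ ms, ‖∑ s ∈ Ys r, b r s * e (x m * P₁ r s + y m * P₂ r s)‖) ^ 2 ≤
      (∑ c ∈ Finset.range D, ∑ r ∈ Rs, Tcr c r) ^ 2 := pow_le_pow_left₀ hT0 hstep1 2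
  refine hsq.trans ?_
  have hCS : (∑ c ∈ Finset.range D, ∑ r ∈ Rs, Tcr c r) ^ 2 ≤
      (Finset.range D).card * ∑ c ∈ Finset.range D, (∑ r ∈ Rs, Tcr c r) ^ 2 :=
    sq_sum_le_card_mul_sum_sq
  refine hCS.trans ?_
  rw [Finset.card_range]
  calc (D : ℝ) * ∑ c ∈ Finset.range D, (∑ r ∈ Rs, Tcr c r) ^ 2
      ≤ D * ∑ c ∈ Finset.range D, (Rs.card * (624 ^ 2 * ((1 + X₁) * (1 + μ * X₂)) * Bv * Nv)) := by
        apply mul_le_mul_of_nonneg_left _ (by positivity)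
        exact Finset.sum_le_sum fun c hc => hstep3 c (Finset.mem_range.mp hc)
    _ = 624 ^ 2 * (D : ℝ) ^ 2 * Rs.card * ((1 + X₁) * (1 + μ * X₂)) * Nv * Bv := by
        rw [Finset.sum_const, Finset.card_range, nsmul_eq_mul]; ring

end RobertSargos
end Literature.NumberTheory.LFunctions

end
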